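import Literature.MathematicalPhysics.QuantumFieldTheory.Balaban1983to89.B15SU2ChartHolomorphic
import Literature.MathematicalPhysics.QuantumFieldTheory.Balaban1983to89.B15ShellGauge193

/-!
# `Balaban1983to89.B15ExtensionHolomorphic` — [Balaban1989LargeFieldI] = «[IV]», p. 193 (the extension `V_k ↦ V̂_k` through the generalized axial gauge on the shell
# `∂⁺Λ`), Prop. 1 p. 194 (last clause); [Balaban1985Variational] p. 307, Prop. 9 (190) p. 309; [Balaban1985Averaging] (9) p. 18:
# THE COMPLEXIFIED SHELL GAUGE AND EXTENSION — holonomies with ADJUGATE inverses; agreement with `B15Extension193.extend ∘ B15ShellGauge193.shellGauge` on `SU(N)` data;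
# ℂ-differentiability; the unitary real structure `θ`

Honest framing: statement-level skeleton of published theorems with citation tags; proofs where landed; nothing here is a claim about the
Yang–Mills mass gap.  Cell `pub-ymgap`, HUMAN RULING D-0149 (width seats), seat `pub-ymgap-dag-n12-w1` (N12 = [B15]; U1a ∕ U1A-CENSUS item (δ′) step 1); count-neutral;
N12 NOT discharged; finite 𝕋⁴ at fixed ε; nothing continuum ∕ OS ∕ mass-gap ∕ Clay.

WHY.  The N12 analytic letters are posed on the configuration `expMul su2Chart B′ (ext (expMul su2Chart p V_k))` with `ext V = extend (pts k Λ) (shellGauge V lo hi) V` (dag-n12-c,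
`B15Extension193` ∕ `B15ShellGauge193`: [IV] p. 193 «we apply the inverse gauge transformation on ∂⁺Λ, and we get a configuration V_k defined on the whole domain»).  The
complex implicit-function route to the intrinsic letter (J0′) (this seat: `ConstrainedCriticalFamily`, `B15AveragingHolomorphic`, `B15SU2ChartHolomorphic`) needs `ext` as a
ℂ-DIFFERENTIABLE map of `M₂(ℂ)`-valued fields.  `shellGauge` is a HOLONOMY (`B7Prop1Explicit.hol` along `pathWord`, generic over a `Group`), `extend` a gauge action with
inverses; on `SU(N)` every inverse is an ADJUGATE, which is polynomial.  THIS MODULE writes the adjugate editions `holC ∕ shellFnC ∕ shellGaugeC ∕ gaugeActC ∕ cutoffC ∕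
primedC ∕ extendC ∕ extC`, proves that on `SU(N)` data they ARE the matrices of the objects of record, that they are ℂ-differentiable functions of the (finitely many) bond
matrices, and that they commute with the unitary real structure `θ(A) = (A⋆)⁻¹` at invertible fields (the symmetry input of `ConstrainedCriticalFamily.criticalFamily_equivariant`).

CONTENTS.  §1 `stepHolC`, ★ `holC` (DEFS), `holC_nil∕cons`, ★ `holC_coe` (`= ↑(hol V x w)` on `SU(N)` data), ★ `differentiable_holC_pull` (as a function of the torus field),
`holC_theta`, `isUnit_det_holC`.  §2 `shellFnC`, `shellGaugeC`, `gaugeActC`, `cutoffC`, `primedC`, `extendC`, ★ `extC` (DEFS, the shapes of record with `adj` for `⁻¹`);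
★★ `shellGaugeC_coeField`, `gaugeActC_coe`, `primedC_coeField`, `extendC_coeField`, ★★★ `extC_coeField` (`extC (↑V) = ↑(extend (pts k Λ) (shellGauge V lo hi) V)`);
★★ `differentiable_shellGaugeC`, `differentiable_gaugeActC`, `differentiable_cutoffC`, `differentiable_primedC`, `differentiable_extendC`, ★★ `differentiable_extC`; the unitary real
structure at invertible fields: `cutoffC_theta`, `gaugeActC_theta`, `primedC_theta`, ★ `extendC_theta`, ★ `shellGaugeC_theta`, ★★ `extC_theta` (+ `isUnit_det_*` bookkeeping).
No estimate of print; no `instance`, no `sorry`.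
-/

noncomputable section

namespace Literature.MathematicalPhysics.QuantumFieldTheory.Balaban1983to89.B15ExtensionHolomorphic

open Literature.MathematicalPhysics.QuantumFieldTheory.Balaban1983to89.Node00 (SU coeField coeField_apply)
open B15AveragingHolomorphic (differentiable_adjugate adjugate_coe_eq_star star_inv_mul_star_inv adjugate_star_inv)
open B7Prop1Explicit (hol hol_nil hol_cons stepHol)
open T4AxialGaugeSmallField (castSite pull pull_apply)
open B15ShellGauge193 (pathWord shellFn shellGauge)
open B15Extension193 (Touches cutoff primed extend)
open T4Continuum GaugeField
open scoped Matrix.Norms.L2Operator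

/-! ## §1  Holonomies along lattice words with ADJUGATE inverses -/

section Hol

variable {d N : ℕ}

/-- The complexified step variable: `V(x, μ)` for `+e_μ`, `adj V(x − e_μ, μ)` for `−e_μ` (`B7Prop1Explicit.stepHol` with `adj` for `⁻¹`). [cite: Balaban1985Averaging, (9) p.18; Balaban1985Variational, p.307] -/
def stepHolC (V : (Fin d → ℤ) → Fin d → Matrix (Fin N) (Fin N) ℂ) (x : Fin d → ℤ) (l : B7Prop1Explicit.Letter d) : Matrix (Fin N) (Fin N) ℂ :=
  if l.2 then V x l.1 else (V (x + l.vec) l.1).adjugate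

/-- ★ **THE COMPLEXIFIED PARALLEL TRANSPORT** along a word spelled from `x` (`B7Prop1Explicit.hol` with `adj` for `⁻¹`). [cite: Balaban1985Averaging, (9) p.18; Balaban1985Variational, p.307] -/
def holC (V : (Fin d → ℤ) → Fin d → Matrix (Fin N) (Fin N) ℂ) : (Fin d → ℤ) → List (B7Prop1Explicit.Letter d) → Matrix (Fin N) (Fin N) ℂ
  | _, [] => 1
  | x, l :: w => stepHolC V x l * holC V (x + l.vec) w

/-- `holC V x [] = 1`. [cite: Balaban1985Averaging, (9) p.18 (bookkeeping)] -/
@[simp] theorem holC_nil (V : (Fin d → ℤ) → Fin d → Matrix (Fin N) (Fin N) ℂ) (x : Fin d → ℤ) : holC V x [] = 1 := rfl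

/-- `holC V x (l :: w) = stepHolC V x l · holC V (x + l.vec) w`. [cite: Balaban1985Averaging, (9) p.18 (bookkeeping)] -/
theorem holC_cons (V : (Fin d → ℤ) → Fin d → Matrix (Fin N) (Fin N) ℂ) (x : Fin d → ℤ) (l : B7Prop1Explicit.Letter d) (w : List (B7Prop1Explicit.Letter d)) :
    holC V x (l :: w) = stepHolC V x l * holC V (x + l.vec) w := rfl

/-- On `SU(N)` data the complexified step variable is the matrix of the step variable. [cite: Balaban1985Averaging, (9) p.18 (bookkeeping)] -/
theorem stepHolC_coe (V : (Fin d → ℤ) → Fin d → SU N) (x : Fin d → ℤ) (l : B7Prop1Explicit.Letter d) :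
    stepHolC (fun y μ => ((V y μ : SU N) : Matrix (Fin N) (Fin N) ℂ)) x l = ((stepHol V x l : SU N) : Matrix (Fin N) (Fin N) ℂ) := by
  unfold stepHolC stepHol
  split_ifs
  · rfl
  · rw [adjugate_coe_eq_star]; rfl

/-- ★ **ON `SU(N)` DATA THE COMPLEXIFIED TRANSPORT IS THE MATRIX OF THE TRANSPORT OF RECORD**: `holC ↑V x w = ↑(hol V x w)`. [cite: Balaban1985Averaging, (9) p.18; Balaban1985Variational, p.307] -/
theorem holC_coe (V : (Fin d → ℤ) → Fin d → SU N) : ∀ (x : Fin d → ℤ) (w : List (B7Prop1Explicit.Letter d)),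
    holC (fun y μ => ((V y μ : SU N) : Matrix (Fin N) (Fin N) ℂ)) x w = ((hol V x w : SU N) : Matrix (Fin N) (Fin N) ℂ)
  | x, [] => by rw [holC_nil, hol_nil]; rfl
  | x, l :: w => by rw [holC_cons, hol_cons, Submonoid.coe_mul, stepHolC_coe, holC_coe V (x + l.vec) w]

variable {P : Params} {k : ℕ}

/-- ★ **THE COMPLEXIFIED TRANSPORT OF THE PULL-BACK IS ℂ-DIFFERENTIABLE IN THE TORUS FIELD** (a finite product of bond matrices and their adjugates).
[cite: Balaban1985Variational, Prop. 9 (190) p.309; Balaban1985Averaging, (9) p.18] -/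
theorem differentiable_holC_pull : ∀ (x : Fin P.d → ℤ) (w : List (B7Prop1Explicit.Letter P.d)),
    Differentiable ℂ (fun U : PBond P k → Matrix (Fin N) (Fin N) ℂ => holC (pull U) x w)
  | x, [] => by simp only [holC_nil]; exact differentiable_const _
  | x, l :: w => by
    simp only [holC_cons]
    refine Differentiable.mul ?_ (differentiable_holC_pull (x + l.vec) w)
    have hev : ∀ b : PBond P k, Differentiable ℂ (fun U : PBond P k → Matrix (Fin N) (Fin N) ℂ => U b) := fun b =>
      (ContinuousLinearMap.proj (R := ℂ) (φ := fun _ : PBond P k => Matrix (Fin N) (Fin N) ℂ) b).differentiable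
    by_cases h : l.2 = true
    · have heq : (fun U : PBond P k → Matrix (Fin N) (Fin N) ℂ => stepHolC (pull U) x l) = fun U => U ⟨castSite x, l.1⟩ := by
        funext U; simp [stepHolC, h, pull_apply]
      rw [heq]; exact hev _
    · have heq : (fun U : PBond P k → Matrix (Fin N) (Fin N) ℂ => stepHolC (pull U) x l) =
          (fun A : Matrix (Fin N) (Fin N) ℂ => A.adjugate) ∘ fun U => U ⟨castSite (x + l.vec), l.1⟩ := by
        funext U; simp [stepHolC, h, pull_apply]
      rw [heq]; exact differentiable_adjugate.comp (hev _)

/-- `θ` through the complexified transport at invertible fields: `holC (θ ∘ V) = θ ∘ holC V`. [cite: Balaban1985Variational, p.307 («Gᶜ-valued fields»)] -/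
theorem holC_theta (V : (Fin d → ℤ) → Fin d → Matrix (Fin N) (Fin N) ℂ) (hV : ∀ y μ, IsUnit (V y μ).det) :
    ∀ (x : Fin d → ℤ) (w : List (B7Prop1Explicit.Letter d)), holC (fun y μ => (star (V y μ))⁻¹) x w = (star (holC V x w))⁻¹
  | x, [] => by rw [holC_nil, holC_nil, star_one, inv_one]
  | x, l :: w => by
    rw [holC_cons, holC_cons, star_inv_mul_star_inv, holC_theta V hV (x + l.vec) w]
    congr 1
    unfold stepHolC
    split_ifs
    · rfl
    · exact (adjugate_star_inv _ (hV _ _)).symm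

/-- Invertibility propagates through the complexified transport. [cite: Balaban1985Averaging, (9) p.18 (bookkeeping)] -/
theorem isUnit_det_holC (V : (Fin d → ℤ) → Fin d → Matrix (Fin N) (Fin N) ℂ) (hV : ∀ y μ, IsUnit (V y μ).det) :
    ∀ (x : Fin d → ℤ) (w : List (B7Prop1Explicit.Letter d)), IsUnit (holC V x w).det
  | x, [] => by rw [holC_nil, Matrix.det_one]; exact isUnit_one
  | x, l :: w => by
    rw [holC_cons, Matrix.det_mul]
    refine IsUnit.mul ?_ (isUnit_det_holC V hV _ w)
    unfold stepHolC
    split_ifs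
    · exact hV _ _
    · rw [Matrix.det_adjugate]; exact (hV _ _).pow _

end Hol

/-! ## §2  The complexified shell gauge, gauge action and extension of [IV] p. 193 -/

section Extension

variable {P : Params} {k N : ℕ}

open Classical in
/-- The complexified shell gauge function `g(y) = V(Γ_y)` (`B15ShellGauge193.shellFn` with `holC`). [cite: Balaban1989LargeFieldI, p.193] -/
def shellFnC (V : (Fin P.d → ℤ) → Fin P.d → Matrix (Fin N) (Fin N) ℂ) (lo hi y : Fin P.d → ℤ) : Matrix (Fin N) (Fin N) ℂ :=
  holC V (lo - 1) (pathWord lo hi y)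

open Classical in
/-- The complexified shell gauge on the torus (`B15ShellGauge193.shellGauge` with `holC`; `1` off the big box). [cite: Balaban1989LargeFieldI, p.193] -/
def shellGaugeC (U : PBond P k → Matrix (Fin N) (Fin N) ℂ) (lo hi : Fin P.d → ℤ) : Site P k → Matrix (Fin N) (Fin N) ℂ := fun s =>
  if h : ∃ x : Fin P.d → ℤ, lo - 1 ≤ x ∧ x ≤ hi + 1 ∧ (castSite x : Site P k) = s then
    shellFnC (pull U) lo hi (Classical.choose h) else 1

/-- The complexified gauge action `V^u(b) = u(b₋) V(b) adj u(b₊)` (`GaugeField.gaugeAct` with `adj` for `⁻¹`). [cite: Balaban1985Averaging, (12) p.19; Balaban1985Variational, p.307] -/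
def gaugeActC (u : Site P k → Matrix (Fin N) (Fin N) ℂ) (V : PBond P k → Matrix (Fin N) (Fin N) ℂ) : PBond P k → Matrix (Fin N) (Fin N) ℂ :=
  fun b => u b.src * V b * (u b.tgt).adjugate

open Classical in
/-- The cut-off of a matrix gauge function to `1` on `Λ` (`B15Extension193.cutoff`). [cite: Balaban1989LargeFieldI, p.193] -/
def cutoffC (Λ : Set (Site P k)) (g : Site P k → Matrix (Fin N) (Fin N) ℂ) : Site P k → Matrix (Fin N) (Fin N) ℂ := fun y => if y ∈ Λ then 1 else g y

open Classical in
/-- The complexified `V′` of p. 193 (`B15Extension193.primed` with `gaugeActC`). [cite: Balaban1989LargeFieldI, p.193] -/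
def primedC (Λ : Set (Site P k)) (g : Site P k → Matrix (Fin N) (Fin N) ℂ) (V : PBond P k → Matrix (Fin N) (Fin N) ℂ) :
    PBond P k → Matrix (Fin N) (Fin N) ℂ :=
  fun b => if Touches Λ b then 1 else gaugeActC (cutoffC Λ g) V b

/-- The complexified extension `V̂ = (V′)^{g⁻¹}` of p. 193 (`B15Extension193.extend` with `adj` for `⁻¹`). [cite: Balaban1989LargeFieldI, p.193] -/
def extendC (Λ : Set (Site P k)) (g : Site P k → Matrix (Fin N) (Fin N) ℂ) (V : PBond P k → Matrix (Fin N) (Fin N) ℂ) :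
    PBond P k → Matrix (Fin N) (Fin N) ℂ :=
  gaugeActC (fun y => (cutoffC Λ g y).adjugate) (primedC Λ g V)

/-- ★ **THE COMPLEXIFIED `ext` OF THE N12 ENDPOINTS**: `extC Λ lo hi V = extendC Λ (shellGaugeC V lo hi) V` — the shape `ext V = extend (pts k Λ) (shellGauge V lo hi) V` of the
Prop-1 carrier with adjugates for inverses. [cite: Balaban1989LargeFieldI, p.193, Prop. 1 p.194] -/
def extC (Λ : Set (Site P k)) (lo hi : Fin P.d → ℤ) (V : PBond P k → Matrix (Fin N) (Fin N) ℂ) : PBond P k → Matrix (Fin N) (Fin N) ℂ :=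
  extendC Λ (shellGaugeC V lo hi) V

/-! ### Agreement with the objects of record on `SU(N)` data -/

section Agreement

variable [NeZero N]

/-- On `SU(N)` data: `shellGaugeC ↑U = ↑(shellGauge U)`. [cite: Balaban1989LargeFieldI, p.193] -/
theorem shellGaugeC_coeField (U : GaugeField P k (SU N)) (lo hi : Fin P.d → ℤ) (s : Site P k) :
    shellGaugeC (coeField U) lo hi s = ((shellGauge U lo hi s : SU N) : Matrix (Fin N) (Fin N) ℂ) := by
  unfold shellGaugeC shellGauge
  split_ifs with h
  · unfold shellFnC shellFn
    have hp : (pull (coeField U) : (Fin P.d → ℤ) → Fin P.d → Matrix (Fin N) (Fin N) ℂ) =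
        fun y μ => ((pull U y μ : SU N) : Matrix (Fin N) (Fin N) ℂ) := by
      funext y μ; rfl
    rw [hp, holC_coe]
  · rfl

/-- On `SU(N)` data: `gaugeActC ↑u ↑V = ↑(V^u)`. [cite: Balaban1985Averaging, (12) p.19 (bookkeeping)] -/
theorem gaugeActC_coe (u : GaugeTransf P k (SU N)) (V : GaugeField P k (SU N)) (b : PBond P k) :
    gaugeActC (fun y => ((u y : SU N) : Matrix (Fin N) (Fin N) ℂ)) (coeField V) b = ((gaugeAct u V b : SU N) : Matrix (Fin N) (Fin N) ℂ) := by
  unfold gaugeActC gaugeAct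
  rw [adjugate_coe_eq_star, Submonoid.coe_mul, Submonoid.coe_mul, coeField_apply]
  rfl

/-- On `SU(N)` data: `cutoffC Λ ↑g = ↑(cutoff Λ g)`. [cite: Balaban1989LargeFieldI, p.193 (bookkeeping)] -/
theorem cutoffC_coe (Λ : Set (Site P k)) (g : GaugeTransf P k (SU N)) (y : Site P k) :
    cutoffC Λ (fun y => ((g y : SU N) : Matrix (Fin N) (Fin N) ℂ)) y = ((cutoff Λ g y : SU N) : Matrix (Fin N) (Fin N) ℂ) := by
  unfold cutoffC cutoff
  split_ifs <;> rfl

/-- On `SU(N)` data: `primedC Λ ↑g ↑V = ↑(primed Λ g V)`. [cite: Balaban1989LargeFieldI, p.193 (bookkeeping)] -/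
theorem primedC_coeField (Λ : Set (Site P k)) (g : GaugeTransf P k (SU N)) (V : GaugeField P k (SU N)) (b : PBond P k) :
    primedC Λ (fun y => ((g y : SU N) : Matrix (Fin N) (Fin N) ℂ)) (coeField V) b = ((primed Λ g V b : SU N) : Matrix (Fin N) (Fin N) ℂ) := by
  unfold primedC primed
  split_ifs
  · rfl
  · have hc : (cutoffC Λ fun y => ((g y : SU N) : Matrix (Fin N) (Fin N) ℂ)) = fun y => ((cutoff Λ g y : SU N) : Matrix (Fin N) (Fin N) ℂ) :=
      funext fun y => cutoffC_coe Λ g y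
    rw [hc, gaugeActC_coe]

/-- On `SU(N)` data: `extendC Λ ↑g ↑V = ↑(extend Λ g V)`. [cite: Balaban1989LargeFieldI, p.193] -/
theorem extendC_coeField (Λ : Set (Site P k)) (g : GaugeTransf P k (SU N)) (V : GaugeField P k (SU N)) :
    extendC Λ (fun y => ((g y : SU N) : Matrix (Fin N) (Fin N) ℂ)) (coeField V) = coeField (extend Λ g V) := by
  funext b
  unfold extendC extend
  have hp : primedC Λ (fun y => ((g y : SU N) : Matrix (Fin N) (Fin N) ℂ)) (coeField V) = coeField (primed Λ g V) :=
    funext fun b => primedC_coeField Λ g V b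
  have hg : (fun y => (cutoffC Λ (fun y => ((g y : SU N) : Matrix (Fin N) (Fin N) ℂ)) y).adjugate) =
      fun y => (((cutoff Λ g y)⁻¹ : SU N) : Matrix (Fin N) (Fin N) ℂ) := by
    funext y
    rw [cutoffC_coe, adjugate_coe_eq_star]; rfl
  rw [hp, hg, coeField_apply, gaugeActC_coe]

/-- ★★★ **ON `SU(N)` DATA THE COMPLEXIFIED `ext` IS THE MATRIX OF THE `ext` OF RECORD**: `extC (pts k Λ) lo hi ↑V = ↑(extend (pts k Λ) (shellGauge V lo hi) V)`.
[cite: Balaban1989LargeFieldI, p.193, Prop. 1 p.194] -/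
theorem extC_coeField (Λ : Set (Site P k)) (lo hi : Fin P.d → ℤ) (V : GaugeField P k (SU N)) :
    extC Λ lo hi (coeField V) = coeField (extend Λ (shellGauge V lo hi) V) := by
  unfold extC
  have hs : shellGaugeC (coeField V) lo hi = fun y => ((shellGauge V lo hi y : SU N) : Matrix (Fin N) (Fin N) ℂ) :=
    funext fun s => shellGaugeC_coeField V lo hi s
  rw [hs, extendC_coeField]

end Agreement

/-! ### ℂ-differentiability in the (finitely many) bond matrices -/

/-- ★★ **THE COMPLEXIFIED SHELL GAUGE IS ℂ-DIFFERENTIABLE IN THE FIELD** (sitewise: a holonomy of the pull-back or the constant `1`). [cite: Balaban1985Variational, Prop. 9 (190) p.309; Balaban1989LargeFieldI, p.193] -/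
theorem differentiable_shellGaugeC (lo hi : Fin P.d → ℤ) :
    Differentiable ℂ (fun U : PBond P k → Matrix (Fin N) (Fin N) ℂ => shellGaugeC U lo hi) := by
  classical
  refine differentiable_pi.2 fun s => ?_
  unfold shellGaugeC
  by_cases h : ∃ x : Fin P.d → ℤ, lo - 1 ≤ x ∧ x ≤ hi + 1 ∧ (castSite x : Site P k) = s
  · simp only [h, dif_pos]
    exact differentiable_holC_pull _ _
  · simp only [h, dif_neg, not_false_eq_true]
    exact differentiable_const _

/-- The complexified gauge action is ℂ-differentiable jointly in the gauge function and the field. [cite: Balaban1985Variational, Prop. 9 (190) p.309] -/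
theorem differentiable_gaugeActC {X : Type*} [NormedAddCommGroup X] [NormedSpace ℂ X] {u : X → Site P k → Matrix (Fin N) (Fin N) ℂ}
    {V : X → PBond P k → Matrix (Fin N) (Fin N) ℂ} (hu : Differentiable ℂ u) (hV : Differentiable ℂ V) :
    Differentiable ℂ (fun x => gaugeActC (u x) (V x)) := by
  refine differentiable_pi.2 fun b => ?_
  have hu1 : Differentiable ℂ (fun x => u x b.src) := (differentiable_pi.1 hu) b.src
  have hu2 : Differentiable ℂ (fun x => u x b.tgt) := (differentiable_pi.1 hu) b.tgt
  have hVb : Differentiable ℂ (fun x => V x b) := (differentiable_pi.1 hV) b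
  have h3 : Differentiable ℂ ((fun A : Matrix (Fin N) (Fin N) ℂ => A.adjugate) ∘ fun x => u x b.tgt) := differentiable_adjugate.comp hu2
  exact (hu1.mul hVb).mul h3

/-- The cut-off is ℂ-differentiable in the gauge function. [cite: Balaban1989LargeFieldI, p.193 (bookkeeping)] -/
theorem differentiable_cutoffC (Λ : Set (Site P k)) {X : Type*} [NormedAddCommGroup X] [NormedSpace ℂ X] {g : X → Site P k → Matrix (Fin N) (Fin N) ℂ}
    (hg : Differentiable ℂ g) : Differentiable ℂ (fun x => cutoffC Λ (g x)) := by
  classical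
  refine differentiable_pi.2 fun y => ?_
  unfold cutoffC
  by_cases hy : y ∈ Λ
  · simp only [hy, if_true]; exact differentiable_const _
  · simp only [hy, if_false]; exact (differentiable_pi.1 hg) y

/-- The complexified `V′` is ℂ-differentiable jointly in the gauge function and the field. [cite: Balaban1989LargeFieldI, p.193 (bookkeeping)] -/
theorem differentiable_primedC (Λ : Set (Site P k)) {X : Type*} [NormedAddCommGroup X] [NormedSpace ℂ X] {g : X → Site P k → Matrix (Fin N) (Fin N) ℂ}
    {V : X → PBond P k → Matrix (Fin N) (Fin N) ℂ} (hg : Differentiable ℂ g) (hV : Differentiable ℂ V) :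
    Differentiable ℂ (fun x => primedC Λ (g x) (V x)) := by
  classical
  have hga : Differentiable ℂ (fun x => gaugeActC (cutoffC Λ (g x)) (V x)) := differentiable_gaugeActC (differentiable_cutoffC Λ hg) hV
  refine differentiable_pi.2 fun b => ?_
  by_cases hb : Touches Λ b
  · have heq : (fun x => primedC Λ (g x) (V x) b) = fun _ => (1 : Matrix (Fin N) (Fin N) ℂ) := by
      funext x; simp [primedC, hb]
    rw [heq]; exact differentiable_const _
  · have heq : (fun x => primedC Λ (g x) (V x) b) = fun x => gaugeActC (cutoffC Λ (g x)) (V x) b := by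
      funext x; simp [primedC, hb]
    rw [heq]; exact (differentiable_pi.1 hga) b

/-- The complexified extension is ℂ-differentiable jointly in the gauge function and the field. [cite: Balaban1989LargeFieldI, p.193; Balaban1985Variational, Prop. 9 (190) p.309] -/
theorem differentiable_extendC (Λ : Set (Site P k)) {X : Type*} [NormedAddCommGroup X] [NormedSpace ℂ X] {g : X → Site P k → Matrix (Fin N) (Fin N) ℂ}
    {V : X → PBond P k → Matrix (Fin N) (Fin N) ℂ} (hg : Differentiable ℂ g) (hV : Differentiable ℂ V) :
    Differentiable ℂ (fun x => extendC Λ (g x) (V x)) := by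
  have hcut := differentiable_cutoffC Λ hg
  have hinv : Differentiable ℂ (fun x => fun y => (cutoffC Λ (g x) y).adjugate) := by
    refine differentiable_pi.2 fun y => ?_
    have h1 : Differentiable ℂ ((fun A : Matrix (Fin N) (Fin N) ℂ => A.adjugate) ∘ fun x => cutoffC Λ (g x) y) :=
      differentiable_adjugate.comp ((differentiable_pi.1 hcut) y)
    exact h1
  exact differentiable_gaugeActC hinv (differentiable_primedC Λ hg hV)

/-- ★★ **THE COMPLEXIFIED `ext` IS ℂ-DIFFERENTIABLE IN THE FIELD** (shell gauge, cut-off, gauge actions: products and adjugates of the bond matrices).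
[cite: Balaban1985Variational, Prop. 9 (190) p.309; Balaban1989LargeFieldI, p.193, Prop. 1 p.194] -/
theorem differentiable_extC (Λ : Set (Site P k)) (lo hi : Fin P.d → ℤ) :
    Differentiable ℂ (fun V : PBond P k → Matrix (Fin N) (Fin N) ℂ => extC Λ lo hi V) :=
  differentiable_extendC Λ (differentiable_shellGaugeC lo hi) differentiable_id

/-! ### The unitary real structure `θ(A) = (A⋆)⁻¹` through the complexified extension (at invertible fields) -/

/-- `θ` through the cut-off (`θ 1 = 1`). [cite: Balaban1989LargeFieldI, p.193 (bookkeeping)] -/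
theorem cutoffC_theta (Λ : Set (Site P k)) (g : Site P k → Matrix (Fin N) (Fin N) ℂ) :
    cutoffC Λ (fun y => (star (g y))⁻¹) = fun y => (star (cutoffC Λ g y))⁻¹ := by
  classical
  funext y
  unfold cutoffC
  split_ifs
  · rw [star_one, inv_one]
  · rfl

/-- Cut-off values of an invertible gauge function are invertible. [cite: Balaban1989LargeFieldI, p.193 (bookkeeping)] -/
theorem isUnit_det_cutoffC (Λ : Set (Site P k)) {g : Site P k → Matrix (Fin N) (Fin N) ℂ} (hg : ∀ y, IsUnit (g y).det) (y : Site P k) :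
    IsUnit (cutoffC Λ g y).det := by
  classical
  unfold cutoffC
  split_ifs
  · rw [Matrix.det_one]; exact isUnit_one
  · exact hg y

/-- `θ` through the complexified gauge action at invertible data (`θ` multiplicative, `θ ∘ adj = adj ∘ θ`). [cite: Balaban1985Variational, p.307 (bookkeeping)] -/
theorem gaugeActC_theta {u : Site P k → Matrix (Fin N) (Fin N) ℂ} {V : PBond P k → Matrix (Fin N) (Fin N) ℂ} (hu : ∀ y, IsUnit (u y).det)
    (b : PBond P k) :
    gaugeActC (fun y => (star (u y))⁻¹) (fun b => (star (V b))⁻¹) b = (star (gaugeActC u V b))⁻¹ := by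
  unfold gaugeActC
  rw [star_inv_mul_star_inv, star_inv_mul_star_inv, adjugate_star_inv _ (hu _)]

/-- Values of the complexified gauge action at invertible data are invertible. [cite: Balaban1985Variational, p.307 (bookkeeping)] -/
theorem isUnit_det_gaugeActC {u : Site P k → Matrix (Fin N) (Fin N) ℂ} {V : PBond P k → Matrix (Fin N) (Fin N) ℂ} (hu : ∀ y, IsUnit (u y).det)
    (hV : ∀ b, IsUnit (V b).det) (b : PBond P k) : IsUnit (gaugeActC u V b).det := by
  unfold gaugeActC
  rw [Matrix.det_mul, Matrix.det_mul, Matrix.det_adjugate]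
  exact ((hu _).mul (hV _)).mul ((hu _).pow _)

/-- `θ` through the complexified `V′` at invertible data. [cite: Balaban1989LargeFieldI, p.193 (bookkeeping)] -/
theorem primedC_theta (Λ : Set (Site P k)) {g : Site P k → Matrix (Fin N) (Fin N) ℂ} {V : PBond P k → Matrix (Fin N) (Fin N) ℂ} (hg : ∀ y, IsUnit (g y).det)
    (b : PBond P k) :
    primedC Λ (fun y => (star (g y))⁻¹) (fun b => (star (V b))⁻¹) b = (star (primedC Λ g V b))⁻¹ := by
  classical
  unfold primedC
  split_ifs
  · rw [star_one, inv_one]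
  · rw [cutoffC_theta, gaugeActC_theta (isUnit_det_cutoffC Λ hg)]

/-- Values of the complexified `V′` at invertible data are invertible. [cite: Balaban1989LargeFieldI, p.193 (bookkeeping)] -/
theorem isUnit_det_primedC (Λ : Set (Site P k)) {g : Site P k → Matrix (Fin N) (Fin N) ℂ} {V : PBond P k → Matrix (Fin N) (Fin N) ℂ} (hg : ∀ y, IsUnit (g y).det)
    (hV : ∀ b, IsUnit (V b).det) (b : PBond P k) : IsUnit (primedC Λ g V b).det := by
  classical
  unfold primedC
  split_ifs
  · rw [Matrix.det_one]; exact isUnit_one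
  · exact isUnit_det_gaugeActC (isUnit_det_cutoffC Λ hg) hV b

/-- ★ `θ` THROUGH THE COMPLEXIFIED EXTENSION at invertible data: `extendC Λ (θ∘g) (θ∘V) = θ ∘ extendC Λ g V`. [cite: Balaban1989LargeFieldI, p.193; Balaban1985Variational, p.307] -/
theorem extendC_theta (Λ : Set (Site P k)) {g : Site P k → Matrix (Fin N) (Fin N) ℂ} {V : PBond P k → Matrix (Fin N) (Fin N) ℂ} (hg : ∀ y, IsUnit (g y).det) :
    extendC Λ (fun y => (star (g y))⁻¹) (fun b => (star (V b))⁻¹) = fun b => (star (extendC Λ g V b))⁻¹ := by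
  funext b
  unfold extendC
  have h1 : (fun y => (cutoffC Λ (fun y => (star (g y))⁻¹) y).adjugate) = fun y => (star ((cutoffC Λ g y).adjugate))⁻¹ := by
    funext y
    rw [cutoffC_theta, adjugate_star_inv _ (isUnit_det_cutoffC Λ hg y)]
  have h2 : primedC Λ (fun y => (star (g y))⁻¹) (fun b => (star (V b))⁻¹) = fun b => (star (primedC Λ g V b))⁻¹ :=
    funext fun b => primedC_theta Λ hg b
  have h3 : ∀ y, IsUnit ((cutoffC Λ g y).adjugate).det := fun y => by
    rw [Matrix.det_adjugate]; exact (isUnit_det_cutoffC Λ hg y).pow _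
  rw [h1, h2, gaugeActC_theta h3]

/-- ★ `θ` THROUGH THE COMPLEXIFIED SHELL GAUGE at invertible fields. [cite: Balaban1989LargeFieldI, p.193; Balaban1985Variational, p.307] -/
theorem shellGaugeC_theta {V : PBond P k → Matrix (Fin N) (Fin N) ℂ} (hV : ∀ b, IsUnit (V b).det) (lo hi : Fin P.d → ℤ) :
    shellGaugeC (fun b => (star (V b))⁻¹) lo hi = fun s => (star (shellGaugeC V lo hi s))⁻¹ := by
  classical
  funext s
  unfold shellGaugeC
  split_ifs with h
  · unfold shellFnC
    have hp : (pull (fun b => (star (V b))⁻¹) : (Fin P.d → ℤ) → Fin P.d → Matrix (Fin N) (Fin N) ℂ) = fun y μ => (star (pull V y μ))⁻¹ := by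
      funext y μ; rfl
    rw [hp]
    exact holC_theta (pull V) (fun y μ => hV _) _ _
  · rw [star_one, inv_one]

/-- Values of the complexified shell gauge at invertible fields are invertible. [cite: Balaban1989LargeFieldI, p.193 (bookkeeping)] -/
theorem isUnit_det_shellGaugeC {V : PBond P k → Matrix (Fin N) (Fin N) ℂ} (hV : ∀ b, IsUnit (V b).det) (lo hi : Fin P.d → ℤ) (s : Site P k) :
    IsUnit (shellGaugeC V lo hi s).det := by
  classical
  unfold shellGaugeC
  split_ifs
  · exact isUnit_det_holC (pull V) (fun y μ => hV _) _ _
  · rw [Matrix.det_one]; exact isUnit_one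

/-- ★★ **`θ` THROUGH THE COMPLEXIFIED `ext`** at invertible fields: `extC Λ lo hi (θ ∘ V) = θ ∘ extC Λ lo hi V` — the symmetry input of
`ConstrainedCriticalFamily.criticalFamily_equivariant` for the datum extension. [cite: Balaban1989LargeFieldI, p.193, Prop. 1 p.194; Balaban1985Variational, p.307, Prop. 9 p.309] -/
theorem extC_theta (Λ : Set (Site P k)) (lo hi : Fin P.d → ℤ) {V : PBond P k → Matrix (Fin N) (Fin N) ℂ} (hV : ∀ b, IsUnit (V b).det) :
    extC Λ lo hi (fun b => (star (V b))⁻¹) = fun b => (star (extC Λ lo hi V b))⁻¹ := by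
  unfold extC
  rw [shellGaugeC_theta hV]
  exact extendC_theta Λ (isUnit_det_shellGaugeC hV lo hi)

end Extension

end Literature.MathematicalPhysics.QuantumFieldTheory.Balaban1983to89.B15ExtensionHolomorphic

end
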